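import Summits.QuantumFields.BalabanUV.T4Continuum.Support.NE7SliceIterationStateNL
import Summits.QuantumFields.BalabanUV.T4Continuum.Support.NE7SliceFrameMatchingLimit
import HarnessLib

/-!
# NE7SliceTangentPartLimitNL — THE CONTINUITY HALF FOR THE (S1) ITERATION ON THE NONLINEAR FRAME TARGET ((R1′), named ask [NE7P1-G103-ASK-4]): along a sitewise-uniformly convergent
# orbit whose NL defect `D̃f` tends to zero, the limit `u⋆` has `T̃(u⋆) ∈ 𝒯_E(W)`, matched frames `framePotW T̃(u⋆) = h̃(u⋆)` — i.e. `mlog v_{k+1}(X(u⋆)) = h(u⋆) + framePotW Ñ(u⋆)`,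
# (1.37) up to the N-frame — and `m̃(u⋆) = 0`; the p767281 ∕ p768804 argument run on t4-ne7-p1 g103's state maps `NE7SliceIterationStateNL` (`P = frameDefect`, `h̃ = effCornerLog`,
# `φ̃ = coarseDatumNL`, `Ñ = normalPartNL`, `T̃ = tangentPartNL`, `ζ̃, Ỹ`, `m̃ = frameMismatchNL`, `D̃f = sliceDefectNL`)

Cell `pub-balaban`, rung (B)+1 sub-cell t4, lineage `b2b-balaban-t4-ne7b-p1`, generation 151 (OWNER of BINDER row NE7b; junction service for the NE crew, ruling R-OWNER-149-1 (2)).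
A JUNCTION for row NE7 (node U5), asked by name ([NE7P1-G103-INBOX-1] ∕ ROAD-G103 §3).  The ONLY new analytic input relative to the linear chain is the sup-Lipschitz letter of the
frame defect `P(X) = mlog v_{k+1}(X) − framePotW X` in the chart field — the road's (LP) (`NE7FrameDefectLipschitz`, t4-ne7-p1 g103) — which THIS FILE keeps DISPLAYED as the hypothesis
`hLP` with a free constant `KP ≥ 0` (instantiate with (LP) when it lands: on the working region `‖X‖, ‖X′‖ ≤ 1∕8`).  The NL working-region facts that the road's one-step analysis proves
anyway (skewness of `φ̃(u)`, existence of the normalised split of `(T̃(u), h̃(u))`, `N`-periodicity of the `m̃`-integrand) are likewise DISPLAYED, lemma-shaped (`hskewNL`, `hsplitNL`,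
`hperNL`), so nothing of the road's inventory is re-typed here.  Everything else is by name: `NE7SliceTangentPartLimit` (`norm_repLog_sub_le_sup`, `norm_cornerLog_sub_le`,
`norm_coarseDatum_sub_le`), `NE7RightInverseLinear.rightInvW_sub`, R5 `NE3RightInverseSupLetters.norm_rightInvW_le` ∕ `norm_gaugeDir_le_two_mul`, `NE7SliceFrameMatchingLimit.framePotW_sub`
∕ `norm_framePotW_sub_le`, `NE7EnergySliceClosed.mem_energyBlockLandauW_of_tendsto`, `NE7SliceLimitWorkingRegion.workingRegion_of_limit`, `NE7SliceIterationStateNL.coarseDatumNL_eq`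
∕ `normalPartNL_eq` ∕ `splitNL_spec`.
WHAT ([folklore]; 0 def, 0 sorry; multi-level small-field class at `W`, `L ≥ 2`, `M = L^{k+1}`).
§1 two states `u, v` of the working region, `sup‖u − v‖ ≤ ρ`: `norm_frameDefect_sub_le` (`≤ KP·(8∕3)ρ`), `norm_effCornerLog_sub_le`, `norm_coarseDatumNL_sub_le`, `norm_normalPartNL_sub_le`,
   **`norm_tangentPartNL_sub_le`** (`≤ lipTNL·ρ`), **`norm_frameIntegrandNL_sub_le`** (the `m̃`-integrand is sup-Lipschitz).
§2 one state: `norm_slicePartNL_sub_tangentPartNL_le` (`≤ D̃f(u)`), `norm_frameNL_le_frameMismatchNL` (`≤ m̃(u)`), `frameMismatchNL_le_sliceDefectNL` (`m̃ ≤ M·D̃f`).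
§3 the limit, rate shape (working region + NL facts for every `u j` AND for `u⋆`, `‖u j y − u⋆ y‖ ≤ r j → 0`, `D̃f(u j) → 0`): **`tangentPartNL_limit_mem`**, **`framePotW_NL_limit_eq`**
   (`∀ z, framePotW T̃(u⋆) z = h̃(u⋆) z`), **`mlog_vcov_limit_eq`** (`mlog v_{k+1}(X(u⋆)) z = h(u⋆) z + framePotW Ñ(u⋆) z`), **`frameMismatchNL_limit_eq_zero`**.
The one-call geometric shape (per-`j` facts, sitewise `Tendsto`, rate `C·ϑ^j`, `D̃f(u j) ≤ ϑ^j·δ₀`; NL facts lemma-shaped) is the companion file `NE7SliceLimitNL`.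
HONEST FRAMING (page 1): continuity bookkeeping by name; `hLP`, `hskewNL`, `hsplitNL`, `hperNL` are DISPLAYED hypotheses (the road's (LP) and NL state facts), asserted for nothing here; NOT the
re-issued (S1) engine, NOT (S2), NOT NE7, nothing of row NE7b; spine 0∕9; finite T⁴ rung (B)+1 — NOT infinite volume, NOT mass gap, NOT BetaPertH, NOT Clay.  Continuum YM on T⁴ ⇐ BetaPertH ∧
nine spine estimates (0/9 proved); BetaPertH ⇐ (D1) ∧ (D4) ∧ CAP+tail; G-an2-4 gates asym, D1 and NE2/3/4.
-/

set_option autoImplicit false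

open scoped BigOperators Matrix.Norms.L2Operator Topology
open NormedSpace Finset Filter

namespace Summit.QuantumFields.BalabanUV.T4Continuum.NE7SliceTangentPartLimitNL

open Literature.MathematicalPhysics.QuantumFieldTheory.Balaban1983to89
open B7Prop1Explicit B7Prop2Explicit MatrixLog
open B7Eq92Concrete (vcov)
open T4AveragingDeficitWall (IsUnitaryCfg IsSkewDir SmallField vary)
open T4AveragingDeficitWallBoundary (IsPeriodicCfg)
open AveragingDeficitPeriodicCounting (IsPeriodicDir)
open AveragingDeficitMultiLevelPrep (cavgIter LevelSmall tower)
open BlockAveragePushDirGauge (gaugeDir isPeriodicDir_gaugeDir)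
open NE3EnergyShapes (IsUnitarySite IsPeriodicSite)
open NE3TangentCovariantTower (framePotW)
open NE3QbarIterCovLiftPrep (cruxC)
open NE3SmoothRightInverseW (rightInvW)
open NE3LinearisedAverageSup (curvSum levelData)
open NE3RightInverseSupLetters (norm_rightInvW_le norm_gaugeDir_le_two_mul supC)
open NE3.PairLandauB8Avg (relPert)
open NE7MeanZeroGaugeSliceW (energyBlockLandauW)
open NE7RightInverseLinear (rightInvW_sub)
open NE7EnergySliceClosed (mem_energyBlockLandauW_of_tendsto)
open NE7SliceIterationState (repLog cornerLog coarseDatum IsNormalisedSplit siteSup_le siteSup_nonneg le_siteSup bondSup le_bondSup bondSup_nonneg)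
open NE7SliceIterationStateNL
open NE7SliceTangentPartLimit (norm_repLog_sub_le_sup norm_cornerLog_sub_le norm_coarseDatum_sub_le)
open NE7SliceFrameMatchingLimit (framePotW_sub norm_framePotW_sub_le lipT_nonneg)
open NE7SliceLimitWorkingRegion (workingRegion_of_limit)

noncomputable section

variable {d : ℕ} {n : Type*} [Fintype n] [DecidableEq n] [Nonempty n]

/-! ## §1 Sup-Lipschitz letters between two states of the working region -/

section TwoStates

variable {L : ℕ} (hL : 2 ≤ L) (k : ℕ) {W : Site d → Fin d → (Matrix n n ℂ)ˣ} {x : ℝ} (hWu : IsUnitaryCfg W) (hx : 0 ≤ x) (hs : LevelSmall d L k x)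
  (hWx : SmallField W x) (N : ℕ) [NeZero N] (hθ : cruxC d L * (((L : ℝ) ^ (k + 1)) ^ 2 * x) < 1) (U' : Site d → Fin d → (Matrix n n ℂ)ˣ)
  (hWP : IsPeriodicCfg W ((tower L N (k + 1) : ℕ) : ℤ)) (hU'u : IsUnitaryCfg U') (hU'P : IsPeriodicCfg U' ((tower L N (k + 1) : ℕ) : ℤ))
  (hε : ((L : ℝ) ^ (k + 1)) ^ 2 * x ≤ 1) (hA : curvSum d L (k + 1) x ≤ 2 / 3 * L)
  {KP : ℝ} (hKP : 0 ≤ KP)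
  (hLP : ∀ (X X' : Site d → Fin d → Matrix n n ℂ) (bX : ℝ), (∀ y κ, ‖X y κ‖ ≤ 1 / 8) → (∀ y κ, ‖X' y κ‖ ≤ 1 / 8) → 0 ≤ bX →
    (∀ y κ, ‖X y κ - X' y κ‖ ≤ bX) → ∀ z : Site d,
      ‖(mlog ((vcov L W (relPert W X) (k + 1) z : (Matrix n n ℂ)ˣ) : Matrix n n ℂ) - framePotW L (k + 1) W X z)
          - (mlog ((vcov L W (relPert W X') (k + 1) z : (Matrix n n ℂ)ˣ) : Matrix n n ℂ) - framePotW L (k + 1) W X' z)‖ ≤ KP * bX)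
  {u v : Site d → (Matrix n n ℂ)ˣ} (hu : IsUnitarySite u) (huP : IsPeriodicSite u ((tower L N (k + 1) : ℕ) : ℤ))
  (hgu : gaugeAct u U' = vary W (repLog W U' u) 1) (hXu : ∀ y κ, ‖repLog W U' u y κ‖ ≤ 1 / 8)
  (hcu : ∀ z, ((u (((L : ℤ) ^ (k + 1)) • z) : (Matrix n n ℂ)ˣ) : Matrix n n ℂ) = exp (cornerLog L k u z)) (hhu : ∀ z, ‖cornerLog L k u z‖ ≤ 1 / 8)
  (hv : IsUnitarySite v) (hvP : IsPeriodicSite v ((tower L N (k + 1) : ℕ) : ℤ))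
  (hgv : gaugeAct v U' = vary W (repLog W U' v) 1) (hXv : ∀ y κ, ‖repLog W U' v y κ‖ ≤ 1 / 8)
  (hcv : ∀ z, ((v (((L : ℤ) ^ (k + 1)) • z) : (Matrix n n ℂ)ˣ) : Matrix n n ℂ) = exp (cornerLog L k v z)) (hhv : ∀ z, ‖cornerLog L k v z‖ ≤ 1 / 8)
  {ρ : ℝ} (hρ : ∀ y, ‖((u y : (Matrix n n ℂ)ˣ) : Matrix n n ℂ) - (v y : (Matrix n n ℂ)ˣ)‖ ≤ ρ)

include hWu hU'u hLP hu hv hgu hXu hgv hXv hρ in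
/-- **THE FRAME DEFECT IS SUP-LIPSCHITZ IN THE GAUGE** on the working region: `‖P(u) z − P(v) z‖ ≤ KP·(8∕3)·sup‖u − v‖` ((LP) displayed + `norm_repLog_sub_le_sup`). [folklore] -/
theorem norm_frameDefect_sub_le (z : Site d) : ‖frameDefect L k W U' u z - frameDefect L k W U' v z‖ ≤ KP * (8 / 3 * ρ) := by
  have hρ0 : 0 ≤ ρ := (norm_nonneg _).trans (hρ 0)
  have hX : ∀ y κ, ‖repLog W U' u y κ - repLog W U' v y κ‖ ≤ 8 / 3 * ρ := fun y κ =>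
    norm_repLog_sub_le_sup hWu U' hU'u hu hgu hXu hv hgv hXv hρ y κ
  exact hLP (repLog W U' u) (repLog W U' v) (8 / 3 * ρ) hXu hXv (by positivity) hX z

include hWu hU'u hLP hu hv hgu hXu hgv hXv hcu hhu hcv hhv hρ in
/-- **THE EFFECTIVE CORNER LOGS ARE SUP-LIPSCHITZ**: `‖h̃(u) z − h̃(v) z‖ ≤ (4∕3 + (8∕3)KP)·sup‖u − v‖`. [folklore] -/
theorem norm_effCornerLog_sub_le (z : Site d) : ‖effCornerLog L k W U' u z - effCornerLog L k W U' v z‖ ≤ (4 / 3 + 8 / 3 * KP) * ρ := by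
  have h1 : ‖cornerLog L k u z - cornerLog L k v z‖ ≤ 4 / 3 * ρ :=
    (norm_cornerLog_sub_le k hcu hhu hcv hhv z).trans (mul_le_mul_of_nonneg_left (hρ _) (by norm_num))
  have h2 := norm_frameDefect_sub_le k hWu U' hU'u hLP hu hgu hXu hv hgv hXv hρ z
  have e : effCornerLog L k W U' u z - effCornerLog L k W U' v z
      = (cornerLog L k u z - cornerLog L k v z) - (frameDefect L k W U' u z - frameDefect L k W U' v z) := by
    simp only [effCornerLog]; abel
  rw [e]
  calc ‖(cornerLog L k u z - cornerLog L k v z) - (frameDefect L k W U' u z - frameDefect L k W U' v z)‖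
      ≤ 4 / 3 * ρ + KP * (8 / 3 * ρ) := (norm_sub_le _ _).trans (add_le_add h1 h2)
    _ = (4 / 3 + 8 / 3 * KP) * ρ := by ring

include hL hWu hx hs hWx hWP hU'u hU'P hLP hu huP hgu hXu hcu hhu hv hvP hgv hXv hcv hhv hρ hA in
/-- **`sup‖φ̃(u) − φ̃(v)‖ ≤ (8∕3)((3+12d)M + 1 + 2KP)·sup‖u − v‖`** (`φ̃ = φ + gaugeDir_V P`: the old letter `norm_coarseDatum_sub_le` + `norm_gaugeDir_le_two_mul` on `P(u) − P(v)`). [folklore] -/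
theorem norm_coarseDatumNL_sub_le (z : Site d) (κ : Fin d) :
    ‖coarseDatumNL L k W U' u z κ - coarseDatumNL L k W U' v z κ‖ ≤ 8 / 3 * ((3 + 12 * (d : ℝ)) * (L : ℝ) ^ (k + 1) + 1 + 2 * KP) * ρ := by
  have hL1 : 1 ≤ L := le_trans one_le_two hL
  have h1 := norm_coarseDatum_sub_le hL k hWu hx hs hWx N U' hWP hU'u hU'P hA hu huP hgu hXu hcu hhu hv hvP hgv hXv hcv hhv hρ z κ
  obtain ⟨hVu, -, -, -⟩ := levelData hL1 hWu hx hs hWx (m := k + 1) le_rfl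
  have hP : ∀ w, ‖frameDefect L k W U' u w - frameDefect L k W U' v w‖ ≤ KP * (8 / 3 * ρ) := fun w =>
    norm_frameDefect_sub_le k hWu U' hU'u hLP hu hgu hXu hv hgv hXv hρ w
  have h2 : ‖gaugeDir (cavgIter L (k + 1) W) (frameDefect L k W U' u) z κ - gaugeDir (cavgIter L (k + 1) W) (frameDefect L k W U' v) z κ‖ ≤ 2 * (KP * (8 / 3 * ρ)) := by
    have e : gaugeDir (cavgIter L (k + 1) W) (frameDefect L k W U' u) z κ - gaugeDir (cavgIter L (k + 1) W) (frameDefect L k W U' v) z κ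
        = gaugeDir (cavgIter L (k + 1) W) (fun w => frameDefect L k W U' u w - frameDefect L k W U' v w) z κ := by
      simp only [gaugeDir, T4AveragingDeficitNonAbelian.Ad_sub]
      exact (sub_sub_sub_comm _ _ _ _)
    rw [e]
    exact norm_gaugeDir_le_two_mul hVu _ hP z κ
  have e : coarseDatumNL L k W U' u z κ - coarseDatumNL L k W U' v z κ
      = (coarseDatum L k W U' u z κ - coarseDatum L k W U' v z κ)
        + (gaugeDir (cavgIter L (k + 1) W) (frameDefect L k W U' u) z κ - gaugeDir (cavgIter L (k + 1) W) (frameDefect L k W U' v) z κ) := by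
    rw [coarseDatumNL_eq, coarseDatumNL_eq]; abel
  rw [e]
  calc ‖(coarseDatum L k W U' u z κ - coarseDatum L k W U' v z κ)
        + (gaugeDir (cavgIter L (k + 1) W) (frameDefect L k W U' u) z κ - gaugeDir (cavgIter L (k + 1) W) (frameDefect L k W U' v) z κ)‖
      ≤ 8 / 3 * ((3 + 12 * (d : ℝ)) * (L : ℝ) ^ (k + 1) + 1) * ρ + 2 * (KP * (8 / 3 * ρ)) := (norm_add_le _ _).trans (add_le_add h1 h2)
    _ = 8 / 3 * ((3 + 12 * (d : ℝ)) * (L : ℝ) ^ (k + 1) + 1 + 2 * KP) * ρ := by ring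

include hL hWu hx hs hWx hWP hU'u hU'P hLP hKP hu huP hgu hXu hcu hhu hv hvP hgv hXv hcv hhv hρ hA hε in
/-- **`sup‖Ñ(u) − Ñ(v)‖ ≤ (supC∕(M(1 − cruxC·M²x)))·(8∕3)((3+12d)M + 1 + 2KP)·sup‖u − v‖`** on the working region, given the skewness of `φ̃(u)`, `φ̃(v)` (the road's NL state fact)
(`rightInvW_sub` + (R5)). [folklore] -/
theorem norm_normalPartNL_sub_le (hφu : IsSkewDir (coarseDatumNL L k W U' u)) (hφv : IsSkewDir (coarseDatumNL L k W U' v)) (y : Site d) (μ : Fin d) :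
    ‖normalPartNL hL k hWu hx hs hWx N hθ U' u y μ - normalPartNL hL k hWu hx hs hWx N hθ U' v y μ‖
      ≤ supC d L / ((L : ℝ) ^ (k + 1) * (1 - cruxC d L * (((L : ℝ) ^ (k + 1)) ^ 2 * x)))
        * (8 / 3 * ((3 + 12 * (d : ℝ)) * (L : ℝ) ^ (k + 1) + 1 + 2 * KP) * ρ) := by
  have hφd : IsSkewDir (fun y μ => coarseDatumNL L k W U' u y μ - coarseDatumNL L k W U' v y μ) := fun y μ =>
    (skewAdjoint (Matrix n n ℂ)).sub_mem (hφu y μ) (hφv y μ)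
  have hρ0 : 0 ≤ ρ := (norm_nonneg _).trans (hρ 0)
  rw [normalPartNL_eq hL k hWu hx hs hWx N hθ U' hφu, normalPartNL_eq hL k hWu hx hs hWx N hθ U' hφv,
    ← rightInvW_sub hL k hWu hx hs hWx hθ hφu hφv hφd y μ]
  have hd0 : (0 : ℝ) ≤ (3 + 12 * (d : ℝ)) * (L : ℝ) ^ (k + 1) + 1 + 2 * KP := by positivity
  have hs0 : 0 ≤ 8 / 3 * ((3 + 12 * (d : ℝ)) * (L : ℝ) ^ (k + 1) + 1 + 2 * KP) * ρ := mul_nonneg (mul_nonneg (by norm_num) hd0) hρ0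
  exact norm_rightInvW_le hL k hWu hx hs hWx N hθ hε hφd hs0
    (fun z κ => norm_coarseDatumNL_sub_le hL k hWu hx hs hWx N U' hWP hU'u hU'P hA hLP hu huP hgu hXu hcu hhu hv hvP hgv hXv hcv hhv hρ z κ) y μ

include hL hWu hx hs hWx hWP hU'u hU'P hLP hKP hu huP hgu hXu hcu hhu hv hvP hgv hXv hcv hhv hρ hA hε in
/-- **THE NL TANGENT PART IS SUP-LIPSCHITZ IN THE GAUGE**: `‖T̃(u)(b) − T̃(v)(b)‖ ≤ lipTNL·sup‖u − v‖`,
`lipTNL = (8∕3)(1 + (supC∕(M(1 − cruxC·M²x)))·((3+12d)M + 1 + 2KP))`. [folklore] -/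
theorem norm_tangentPartNL_sub_le (hφu : IsSkewDir (coarseDatumNL L k W U' u)) (hφv : IsSkewDir (coarseDatumNL L k W U' v)) (y : Site d) (μ : Fin d) :
    ‖tangentPartNL hL k hWu hx hs hWx N hθ U' u y μ - tangentPartNL hL k hWu hx hs hWx N hθ U' v y μ‖
      ≤ (8 / 3 * (1 + supC d L / ((L : ℝ) ^ (k + 1) * (1 - cruxC d L * (((L : ℝ) ^ (k + 1)) ^ 2 * x))) * ((3 + 12 * (d : ℝ)) * (L : ℝ) ^ (k + 1) + 1 + 2 * KP))) * ρ := by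
  have h1 := norm_repLog_sub_le_sup hWu U' hU'u hu hgu hXu hv hgv hXv hρ y μ
  have h2 := norm_normalPartNL_sub_le hL k hWu hx hs hWx N hθ U' hWP hU'u hU'P hε hA hKP hLP hu huP hgu hXu hcu hhu hv hvP hgv hXv hcv hhv hρ hφu hφv y μ
  have e : tangentPartNL hL k hWu hx hs hWx N hθ U' u y μ - tangentPartNL hL k hWu hx hs hWx N hθ U' v y μ
      = (repLog W U' u y μ - repLog W U' v y μ) - (normalPartNL hL k hWu hx hs hWx N hθ U' u y μ - normalPartNL hL k hWu hx hs hWx N hθ U' v y μ) :=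
    sub_sub_sub_comm _ _ _ _
  rw [e]
  calc ‖(repLog W U' u y μ - repLog W U' v y μ) - (normalPartNL hL k hWu hx hs hWx N hθ U' u y μ - normalPartNL hL k hWu hx hs hWx N hθ U' v y μ)‖
      ≤ 8 / 3 * ρ + supC d L / ((L : ℝ) ^ (k + 1) * (1 - cruxC d L * (((L : ℝ) ^ (k + 1)) ^ 2 * x)))
          * (8 / 3 * ((3 + 12 * (d : ℝ)) * (L : ℝ) ^ (k + 1) + 1 + 2 * KP) * ρ) := (norm_sub_le _ _).trans (add_le_add h1 h2)
    _ = _ := by ring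

include hL hWu hx hs hWx hWP hU'u hU'P hLP hKP hu huP hgu hXu hcu hhu hv hvP hgv hXv hcv hhv hρ hA hε in
/-- **THE `m̃`-INTEGRAND IS SUP-LIPSCHITZ**: `‖(framePotW T̃(u) z − h̃(u) z) − (framePotW T̃(v) z − h̃(v) z)‖ ≤ (6dM·lipTNL + 4∕3 + (8∕3)KP)·sup‖u − v‖`
(`norm_framePotW_sub_le` on `T̃(u) − T̃(v)` + `norm_effCornerLog_sub_le`). [folklore] -/
theorem norm_frameIntegrandNL_sub_le (hφu : IsSkewDir (coarseDatumNL L k W U' u)) (hφv : IsSkewDir (coarseDatumNL L k W U' v)) (z : Site d) :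
    ‖(framePotW L (k + 1) W (tangentPartNL hL k hWu hx hs hWx N hθ U' u) z - effCornerLog L k W U' u z)
        - (framePotW L (k + 1) W (tangentPartNL hL k hWu hx hs hWx N hθ U' v) z - effCornerLog L k W U' v z)‖
      ≤ (6 * (d : ℝ) * (L : ℝ) ^ (k + 1)
            * (8 / 3 * (1 + supC d L / ((L : ℝ) ^ (k + 1) * (1 - cruxC d L * (((L : ℝ) ^ (k + 1)) ^ 2 * x))) * ((3 + 12 * (d : ℝ)) * (L : ℝ) ^ (k + 1) + 1 + 2 * KP)))
          + (4 / 3 + 8 / 3 * KP)) * ρ := by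
  have hρ0 : 0 ≤ ρ := (norm_nonneg _).trans (hρ 0)
  have hlip : 0 ≤ 8 / 3 * (1 + supC d L / ((L : ℝ) ^ (k + 1) * (1 - cruxC d L * (((L : ℝ) ^ (k + 1)) ^ 2 * x))) * ((3 + 12 * (d : ℝ)) * (L : ℝ) ^ (k + 1) + 1 + 2 * KP)) := by
    have hsupC : 0 ≤ supC d L := by
      unfold supC NE3RightInverseSupLetters.corrC NE3RightInverseSupLetters.frameC; have := NE3QbarIterCovLiftPrep.liftC_nonneg d; positivity
    have hM : 0 < (L : ℝ) ^ (k + 1) := pow_pos (by exact_mod_cast (by omega : 0 < L)) _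
    have hden : 0 < (L : ℝ) ^ (k + 1) * (1 - cruxC d L * (((L : ℝ) ^ (k + 1)) ^ 2 * x)) := mul_pos hM (by linarith)
    have h1 : 0 ≤ supC d L / ((L : ℝ) ^ (k + 1) * (1 - cruxC d L * (((L : ℝ) ^ (k + 1)) ^ 2 * x))) := div_nonneg hsupC hden.le
    positivity
  have h1 := norm_framePotW_sub_le hL k hWu hx hs hWx hA (mul_nonneg hlip hρ0)
    (fun y μ => norm_tangentPartNL_sub_le hL k hWu hx hs hWx N hθ U' hWP hU'u hU'P hε hA hKP hLP hu huP hgu hXu hcu hhu hv hvP hgv hXv hcv hhv hρ hφu hφv y μ) z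
  have h2 := norm_effCornerLog_sub_le k hWu U' hU'u hLP hu hgu hXu hcu hhu hv hgv hXv hcv hhv hρ z
  have e : (framePotW L (k + 1) W (tangentPartNL hL k hWu hx hs hWx N hθ U' u) z - effCornerLog L k W U' u z)
        - (framePotW L (k + 1) W (tangentPartNL hL k hWu hx hs hWx N hθ U' v) z - effCornerLog L k W U' v z)
      = (framePotW L (k + 1) W (tangentPartNL hL k hWu hx hs hWx N hθ U' u) z - framePotW L (k + 1) W (tangentPartNL hL k hWu hx hs hWx N hθ U' v) z)
        - (effCornerLog L k W U' u z - effCornerLog L k W U' v z) := sub_sub_sub_comm _ _ _ _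
  rw [e]
  calc ‖(framePotW L (k + 1) W (tangentPartNL hL k hWu hx hs hWx N hθ U' u) z - framePotW L (k + 1) W (tangentPartNL hL k hWu hx hs hWx N hθ U' v) z)
        - (effCornerLog L k W U' u z - effCornerLog L k W U' v z)‖
      ≤ 6 * (d : ℝ) * (L : ℝ) ^ (k + 1)
            * ((8 / 3 * (1 + supC d L / ((L : ℝ) ^ (k + 1) * (1 - cruxC d L * (((L : ℝ) ^ (k + 1)) ^ 2 * x))) * ((3 + 12 * (d : ℝ)) * (L : ℝ) ^ (k + 1) + 1 + 2 * KP))) * ρ)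
          + (4 / 3 + 8 / 3 * KP) * ρ := (norm_sub_le _ _).trans (add_le_add h1 h2)
    _ = _ := by ring

end TwoStates

/-! ## §2 One state: access letters through the chosen split and the NL mismatch -/

section OneState

variable {L : ℕ} (hL : 2 ≤ L) (k : ℕ) {W : Site d → Fin d → (Matrix n n ℂ)ˣ} {x : ℝ} (hWu : IsUnitaryCfg W) (hx : 0 ≤ x) (hs : LevelSmall d L k x)
  (hWx : SmallField W x) (N : ℕ) [NeZero N] (hθ : cruxC d L * (((L : ℝ) ^ (k + 1)) ^ 2 * x) < 1) (U' : Site d → Fin d → (Matrix n n ℂ)ˣ)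
  (hWP : IsPeriodicCfg W ((tower L N (k + 1) : ℕ) : ℤ)) {u : Site d → (Matrix n n ℂ)ˣ}

include hWP in
/-- **`‖Ỹ̃(u)(b) − T̃(u)(b)‖ ≤ D̃f(u)`** whenever the normalised split of `(T̃(u), h̃(u))` exists (`Ỹ̃ = T̃ − gaugeDir W ζ̃`, `‖gaugeDir W ζ̃‖ ≤ δ̃ ≤ D̃f`). [folklore] -/
theorem norm_slicePartNL_sub_tangentPartNL_le
    (hex : ∃ p : (Site d → Matrix n n ℂ) × (Site d → Fin d → Matrix n n ℂ),
      IsNormalisedSplit L k N W (tangentPartNL hL k hWu hx hs hWx N hθ U' u) (effCornerLog L k W U' u) p.1 p.2) (y : Site d) (μ : Fin d) :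
    ‖slicePartNL hL k hWu hx hs hWx N hθ U' u y μ - tangentPartNL hL k hWu hx hs hWx N hθ U' u y μ‖ ≤ sliceDefectNL hL k hWu hx hs hWx N hθ U' u := by
  haveI : NeZero L := ⟨by omega⟩
  obtain ⟨-, hζP, -, hsplit, -⟩ := splitNL_spec hL k hWu hx hs hWx N hθ U' hex
  have e : slicePartNL hL k hWu hx hs hWx N hθ U' u y μ - tangentPartNL hL k hWu hx hs hWx N hθ U' u y μ
      = -gaugeDir W (gaugeFunNL hL k hWu hx hs hWx N hθ U' u) y μ := by rw [hsplit y μ]; exact sub_add_cancel_left _ _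
  rw [e, norm_neg]
  have hM : 0 < (L : ℝ) ^ (k + 1) := pow_pos (by exact_mod_cast (by omega : 0 < L)) _
  have hP := isPeriodicDir_gaugeDir hWP hζP
  have hδ : ‖gaugeDir W (gaugeFunNL hL k hWu hx hs hWx N hθ U' u) y μ‖
      ≤ bondSup (tower L N (k + 1)) (fun y μ => ‖gaugeDir W (gaugeFunNL hL k hWu hx hs hWx N hθ U' u) y μ‖) :=
    le_bondSup (Nat.one_le_iff_ne_zero.mpr (NeZero.ne _)) (F := fun y μ => ‖gaugeDir W (gaugeFunNL hL k hWu hx hs hWx N hθ U' u) y μ‖)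
      (fun x' κ μ' => by simp only [hP x' κ μ']) y μ
  exact hδ.trans (le_add_of_nonneg_right (div_nonneg (siteSup_nonneg fun z => norm_nonneg _) hM.le))

/-- **`‖framePotW T̃(u) z − h̃(u) z‖ ≤ m̃(u)`** everywhere, given the `N`-periodicity of the integrand (box sup of a periodic function). [folklore] -/
theorem norm_frameNL_le_frameMismatchNL
    (hper : ∀ (z : Site d) (i : Fin d), framePotW L (k + 1) W (tangentPartNL hL k hWu hx hs hWx N hθ U' u) (z + (N : ℤ) • e i) - effCornerLog L k W U' u (z + (N : ℤ) • e i)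
      = framePotW L (k + 1) W (tangentPartNL hL k hWu hx hs hWx N hθ U' u) z - effCornerLog L k W U' u z) (z : Site d) :
    ‖framePotW L (k + 1) W (tangentPartNL hL k hWu hx hs hWx N hθ U' u) z - effCornerLog L k W U' u z‖ ≤ frameMismatchNL hL k hWu hx hs hWx N hθ U' u :=
  le_siteSup (Nat.one_le_iff_ne_zero.mpr (NeZero.ne N)) (f := fun z => ‖framePotW L (k + 1) W (tangentPartNL hL k hWu hx hs hWx N hθ U' u) z - effCornerLog L k W U' u z‖)
    (fun x' κ => by simp only [hper x' κ]) z

/-- `m̃(u) ≤ M·D̃f(u)` (`δ̃(u) ≥ 0`, `L ≥ 2`). [folklore] -/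
theorem frameMismatchNL_le_sliceDefectNL (u : Site d → (Matrix n n ℂ)ˣ) :
    frameMismatchNL hL k hWu hx hs hWx N hθ U' u ≤ (L : ℝ) ^ (k + 1) * sliceDefectNL hL k hWu hx hs hWx N hθ U' u := by
  have hM : 0 < (L : ℝ) ^ (k + 1) := pow_pos (by exact_mod_cast (by omega : 0 < L)) _
  have e : (L : ℝ) ^ (k + 1) * sliceDefectNL hL k hWu hx hs hWx N hθ U' u
      = (L : ℝ) ^ (k + 1) * bondSup (tower L N (k + 1)) (fun y μ => ‖gaugeDir W (gaugeFunNL hL k hWu hx hs hWx N hθ U' u) y μ‖)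
        + frameMismatchNL hL k hWu hx hs hWx N hθ U' u := by
    unfold sliceDefectNL; field_simp
  rw [e]
  exact le_add_of_nonneg_left (mul_nonneg hM.le (bondSup_nonneg fun y μ => norm_nonneg _))

end OneState

/-! ## §3 The limit — rate shape -/

section Limit

variable {L : ℕ} (hL : 2 ≤ L) (k : ℕ) {W : Site d → Fin d → (Matrix n n ℂ)ˣ} {x : ℝ} (hWu : IsUnitaryCfg W) (hx : 0 ≤ x) (hs : LevelSmall d L k x)
  (hWx : SmallField W x) (N : ℕ) [NeZero N] (hθ : cruxC d L * (((L : ℝ) ^ (k + 1)) ^ 2 * x) < 1) (U' : Site d → Fin d → (Matrix n n ℂ)ˣ)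
  (hWP : IsPeriodicCfg W ((tower L N (k + 1) : ℕ) : ℤ)) (hU'u : IsUnitaryCfg U') (hU'P : IsPeriodicCfg U' ((tower L N (k + 1) : ℕ) : ℤ))
  (hε : ((L : ℝ) ^ (k + 1)) ^ 2 * x ≤ 1) (hA : curvSum d L (k + 1) x ≤ 2 / 3 * L)
  {KP : ℝ} (hKP : 0 ≤ KP)
  (hLP : ∀ (X X' : Site d → Fin d → Matrix n n ℂ) (bX : ℝ), (∀ y κ, ‖X y κ‖ ≤ 1 / 8) → (∀ y κ, ‖X' y κ‖ ≤ 1 / 8) → 0 ≤ bX →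
    (∀ y κ, ‖X y κ - X' y κ‖ ≤ bX) → ∀ z : Site d,
      ‖(mlog ((vcov L W (relPert W X) (k + 1) z : (Matrix n n ℂ)ˣ) : Matrix n n ℂ) - framePotW L (k + 1) W X z)
          - (mlog ((vcov L W (relPert W X') (k + 1) z : (Matrix n n ℂ)ˣ) : Matrix n n ℂ) - framePotW L (k + 1) W X' z)‖ ≤ KP * bX)
  (u : ℕ → Site d → (Matrix n n ℂ)ˣ) (ulim : Site d → (Matrix n n ℂ)ˣ)
  (hu : ∀ j, IsUnitarySite (u j)) (huP : ∀ j, IsPeriodicSite (u j) ((tower L N (k + 1) : ℕ) : ℤ))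
  (hgu : ∀ j, gaugeAct (u j) U' = vary W (repLog W U' (u j)) 1) (hXu : ∀ j y κ, ‖repLog W U' (u j) y κ‖ ≤ 1 / 8)
  (hcu : ∀ j z, (((u j) (((L : ℤ) ^ (k + 1)) • z) : (Matrix n n ℂ)ˣ) : Matrix n n ℂ) = exp (cornerLog L k (u j) z)) (hhu : ∀ j z, ‖cornerLog L k (u j) z‖ ≤ 1 / 8)
  (hl : IsUnitarySite ulim) (hlP : IsPeriodicSite ulim ((tower L N (k + 1) : ℕ) : ℤ))
  (hgl : gaugeAct ulim U' = vary W (repLog W U' ulim) 1) (hXl : ∀ y κ, ‖repLog W U' ulim y κ‖ ≤ 1 / 8)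
  (hcl : ∀ z, ((ulim (((L : ℤ) ^ (k + 1)) • z) : (Matrix n n ℂ)ˣ) : Matrix n n ℂ) = exp (cornerLog L k ulim z)) (hhl : ∀ z, ‖cornerLog L k ulim z‖ ≤ 1 / 8)
  -- the road's NL state facts along the orbit and at the limit, displayed
  (hφj : ∀ j, IsSkewDir (coarseDatumNL L k W U' (u j))) (hφl : IsSkewDir (coarseDatumNL L k W U' ulim))
  (hexj : ∀ j, ∃ p : (Site d → Matrix n n ℂ) × (Site d → Fin d → Matrix n n ℂ),
      IsNormalisedSplit L k N W (tangentPartNL hL k hWu hx hs hWx N hθ U' (u j)) (effCornerLog L k W U' (u j)) p.1 p.2)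
  (hperj : ∀ j (z : Site d) (i : Fin d),
      framePotW L (k + 1) W (tangentPartNL hL k hWu hx hs hWx N hθ U' (u j)) (z + (N : ℤ) • e i) - effCornerLog L k W U' (u j) (z + (N : ℤ) • e i)
        = framePotW L (k + 1) W (tangentPartNL hL k hWu hx hs hWx N hθ U' (u j)) z - effCornerLog L k W U' (u j) z)
  (r : ℕ → ℝ) (hrate : ∀ j y, ‖(((u j) y : (Matrix n n ℂ)ˣ) : Matrix n n ℂ) - (ulim y : (Matrix n n ℂ)ˣ)‖ ≤ r j) (hr : Tendsto r atTop (𝓝 0))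
  (hDf : Tendsto (fun j => sliceDefectNL hL k hWu hx hs hWx N hθ U' (u j)) atTop (𝓝 0))

include hWP hU'u hU'P hε hA hKP hLP hu huP hgu hXu hcu hhu hl hlP hgl hXl hcl hhl hφj hφl hexj hrate hr hDf in
/-- **`T̃(u⋆) ∈ 𝒯_E(W)`** — the NL tangent part of the limit gauge lies in the energy slice: `Ỹ̃(u j) ∈ 𝒯_E(W)` converge sitewise to `T̃(u⋆)`
(`‖Ỹ̃(u j) − T̃(u⋆)‖ ≤ D̃f(u j) + lipTNL·r j → 0`) and `𝒯_E(W)` is closed (`NE7EnergySliceClosed.mem_energyBlockLandauW_of_tendsto`). [folklore] -/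
theorem tangentPartNL_limit_mem : tangentPartNL hL k hWu hx hs hWx N hθ U' ulim ∈ energyBlockLandauW (d := d) (n := n) L N (k + 1) W := by
  obtain ⟨C, hC⟩ : ∃ C : ℝ, C = 8 / 3 * (1 + supC d L / ((L : ℝ) ^ (k + 1) * (1 - cruxC d L * (((L : ℝ) ^ (k + 1)) ^ 2 * x))) * ((3 + 12 * (d : ℝ)) * (L : ℝ) ^ (k + 1) + 1 + 2 * KP)) := ⟨_, rfl⟩
  refine mem_energyBlockLandauW_of_tendsto hL k hWu hx hs hWx (Y := fun j => slicePartNL hL k hWu hx hs hWx N hθ U' (u j))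
    (fun j => (splitNL_spec hL k hWu hx hs hWx N hθ U' (hexj j)).2.2.1) fun y μ => ?_
  have hbound : ∀ j, ‖slicePartNL hL k hWu hx hs hWx N hθ U' (u j) y μ - tangentPartNL hL k hWu hx hs hWx N hθ U' ulim y μ‖
      ≤ sliceDefectNL hL k hWu hx hs hWx N hθ U' (u j) + C * r j := fun j => by
    have h1 := norm_slicePartNL_sub_tangentPartNL_le hL k hWu hx hs hWx N hθ U' hWP (hexj j) y μ
    have h2 := norm_tangentPartNL_sub_le hL k hWu hx hs hWx N hθ U' hWP hU'u hU'P hε hA hKP hLP (hu j) (huP j) (hgu j) (hXu j) (hcu j) (hhu j)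
      hl hlP hgl hXl hcl hhl (hrate j) (hφj j) hφl y μ
    calc ‖slicePartNL hL k hWu hx hs hWx N hθ U' (u j) y μ - tangentPartNL hL k hWu hx hs hWx N hθ U' ulim y μ‖
        ≤ ‖slicePartNL hL k hWu hx hs hWx N hθ U' (u j) y μ - tangentPartNL hL k hWu hx hs hWx N hθ U' (u j) y μ‖
          + ‖tangentPartNL hL k hWu hx hs hWx N hθ U' (u j) y μ - tangentPartNL hL k hWu hx hs hWx N hθ U' ulim y μ‖ := norm_sub_le_norm_sub_add_norm_sub _ _ _
      _ ≤ sliceDefectNL hL k hWu hx hs hWx N hθ U' (u j) + C * r j := add_le_add h1 (by rw [hC]; exact h2)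
  have hlim0 : Tendsto (fun j => sliceDefectNL hL k hWu hx hs hWx N hθ U' (u j) + C * r j) atTop (𝓝 0) := by
    have := hDf.add (hr.const_mul C)
    simpa using this
  rw [tendsto_iff_norm_sub_tendsto_zero]
  exact squeeze_zero (fun j => norm_nonneg _) hbound hlim0

include hWP hU'u hU'P hε hA hKP hLP hu huP hgu hXu hcu hhu hl hlP hgl hXl hcl hhl hφj hφl hperj hrate hr hDf in
/-- **NL FRAME MATCHING AT THE LIMIT**: `framePotW L (k+1) W T̃(u⋆) z = h̃(u⋆) z` for every `z` (the constant left side is `≤ M·D̃f(u_j) + (6dM·lipTNL + 4∕3 + (8∕3)KP)·r_j → 0`). [folklore] -/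
theorem framePotW_NL_limit_eq (z : Site d) :
    framePotW L (k + 1) W (tangentPartNL hL k hWu hx hs hWx N hθ U' ulim) z = effCornerLog L k W U' ulim z := by
  obtain ⟨C, hC⟩ : ∃ C : ℝ, C = 6 * (d : ℝ) * (L : ℝ) ^ (k + 1)
      * (8 / 3 * (1 + supC d L / ((L : ℝ) ^ (k + 1) * (1 - cruxC d L * (((L : ℝ) ^ (k + 1)) ^ 2 * x))) * ((3 + 12 * (d : ℝ)) * (L : ℝ) ^ (k + 1) + 1 + 2 * KP)))
      + (4 / 3 + 8 / 3 * KP) := ⟨_, rfl⟩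
  have hlim0 : Tendsto (fun j => (L : ℝ) ^ (k + 1) * sliceDefectNL hL k hWu hx hs hWx N hθ U' (u j) + C * r j) atTop (𝓝 0) := by
    simpa using (hDf.const_mul ((L : ℝ) ^ (k + 1))).add (hr.const_mul C)
  -- the finite-`j` letter: constant left-hand side bounded by a null sequence
  have hstep : ∀ j, ‖framePotW L (k + 1) W (tangentPartNL hL k hWu hx hs hWx N hθ U' ulim) z - effCornerLog L k W U' ulim z‖
      ≤ (L : ℝ) ^ (k + 1) * sliceDefectNL hL k hWu hx hs hWx N hθ U' (u j) + C * r j := by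
    intro j
    have h1 : ‖framePotW L (k + 1) W (tangentPartNL hL k hWu hx hs hWx N hθ U' (u j)) z - effCornerLog L k W U' (u j) z‖
        ≤ (L : ℝ) ^ (k + 1) * sliceDefectNL hL k hWu hx hs hWx N hθ U' (u j) :=
      (norm_frameNL_le_frameMismatchNL hL k hWu hx hs hWx N hθ U' (hperj j) z).trans (frameMismatchNL_le_sliceDefectNL hL k hWu hx hs hWx N hθ U' (u j))
    have h2 := norm_frameIntegrandNL_sub_le hL k hWu hx hs hWx N hθ U' hWP hU'u hU'P hε hA hKP hLP (hu j) (huP j) (hgu j) (hXu j) (hcu j) (hhu j)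
      hl hlP hgl hXl hcl hhl (hrate j) (hφj j) hφl z
    rw [hC]
    calc ‖framePotW L (k + 1) W (tangentPartNL hL k hWu hx hs hWx N hθ U' ulim) z - effCornerLog L k W U' ulim z‖
        = ‖(framePotW L (k + 1) W (tangentPartNL hL k hWu hx hs hWx N hθ U' (u j)) z - effCornerLog L k W U' (u j) z)
          - ((framePotW L (k + 1) W (tangentPartNL hL k hWu hx hs hWx N hθ U' (u j)) z - effCornerLog L k W U' (u j) z)
            - (framePotW L (k + 1) W (tangentPartNL hL k hWu hx hs hWx N hθ U' ulim) z - effCornerLog L k W U' ulim z))‖ := by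
          congr 1; abel
      _ ≤ ‖framePotW L (k + 1) W (tangentPartNL hL k hWu hx hs hWx N hθ U' (u j)) z - effCornerLog L k W U' (u j) z‖
          + ‖(framePotW L (k + 1) W (tangentPartNL hL k hWu hx hs hWx N hθ U' (u j)) z - effCornerLog L k W U' (u j) z)
            - (framePotW L (k + 1) W (tangentPartNL hL k hWu hx hs hWx N hθ U' ulim) z - effCornerLog L k W U' ulim z)‖ := norm_sub_le _ _
      _ ≤ _ := add_le_add h1 h2
  exact sub_eq_zero.mp (norm_le_zero_iff.mp (ge_of_tendsto' hlim0 hstep))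

include hWP hU'u hU'P hε hA hKP hLP hu huP hgu hXu hcu hhu hl hlP hgl hXl hcl hhl hφj hφl hperj hrate hr hDf in
/-- **(1.37) UP TO THE N-FRAME AT THE LIMIT**: `mlog v_{k+1}(X(u⋆)) z = h(u⋆) z + framePotW L (k+1) W Ñ(u⋆) z` (`framePotW T̃ = framePotW X − framePotW Ñ`, `h̃ = h − P`,
`P = mlog v − framePotW X`). [folklore] -/
theorem mlog_vcov_limit_eq (z : Site d) :
    mlog ((vcov L W (relPert W (repLog W U' ulim)) (k + 1) z : (Matrix n n ℂ)ˣ) : Matrix n n ℂ)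
      = cornerLog L k ulim z + framePotW L (k + 1) W (normalPartNL hL k hWu hx hs hWx N hθ U' ulim) z := by
  have hF := framePotW_NL_limit_eq hL k hWu hx hs hWx N hθ U' hWP hU'u hU'P hε hA hKP hLP u ulim hu huP hgu hXu hcu hhu hl hlP hgl hXl hcl hhl
    hφj hφl hperj r hrate hr hDf z
  have hT : framePotW L (k + 1) W (tangentPartNL hL k hWu hx hs hWx N hθ U' ulim) z
      = framePotW L (k + 1) W (repLog W U' ulim) z - framePotW L (k + 1) W (normalPartNL hL k hWu hx hs hWx N hθ U' ulim) z :=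
    framePotW_sub hL k hWu hx hs hWx (repLog W U' ulim) (normalPartNL hL k hWu hx hs hWx N hθ U' ulim) z
  rw [hT] at hF
  have hh : effCornerLog L k W U' ulim z = cornerLog L k ulim z
      - (mlog ((vcov L W (relPert W (repLog W U' ulim)) (k + 1) z : (Matrix n n ℂ)ˣ) : Matrix n n ℂ) - framePotW L (k + 1) W (repLog W U' ulim) z) := rfl
  rw [hh] at hF
  -- `F X − F Ñ = h − (mlog v − F X)` ⟹ `mlog v = h + F Ñ`
  have := sub_eq_zero.mpr hF
  rw [← sub_eq_zero]
  rw [← this]; abel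

include hWP hU'u hU'P hε hA hKP hLP hu huP hgu hXu hcu hhu hl hlP hgl hXl hcl hhl hφj hφl hperj hrate hr hDf in
/-- **`m̃(u⋆) = 0`**. [folklore] -/
theorem frameMismatchNL_limit_eq_zero : frameMismatchNL hL k hWu hx hs hWx N hθ U' ulim = 0 := by
  have hF := framePotW_NL_limit_eq hL k hWu hx hs hWx N hθ U' hWP hU'u hU'P hε hA hKP hLP u ulim hu huP hgu hXu hcu hhu hl hlP hgl hXl hcl hhl
    hφj hφl hperj r hrate hr hDf
  refine le_antisymm ?_ (siteSup_nonneg fun z => norm_nonneg _)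
  exact siteSup_le (Nat.one_le_iff_ne_zero.mpr (NeZero.ne N)) fun z => by rw [hF z, sub_self, norm_zero]

end Limit

end

end Summit.QuantumFields.BalabanUV.T4Continuum.NE7SliceTangentPartLimitNL
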